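import Literature.AlgebraicGeometry.Hu2025.Statements.S07GammaSchemes.R109bFTransforms
import Mathlib.RingTheory.Ideal.Maps
import HarnessLib

/-!
# Hu 2025 (arXiv:2507.21400v1) §7.2–§7.4, the maximality clause «further, we take Γ̃⁰_𝔙 ⊂ Var_𝔙 to be the maximal
# subset (under inclusion) among all those subsets that satisfy the above» (Lem. 7.3 (1) C57L127–L129; Lem. 7.4 (1)
# C60L15–L17; Lem. 7.5 (1) C63L19–L21) — KERNEL SUPPORT on the TYPED READINGS of row 109, file
# `R109bFTransforms.lean`: `GammaTransformChart.Gamma0Maximal` (maximal element), `.Gamma0Greatest` (greatest element),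
# `.gamma0Sat` (OURS, the definition reading)

**Honest framing (D-0012/D-0089).** Kernel facts about TYPED decls, taking no side on the manuscript [Hu2025]
(arXiv:2507.21400v1, lit key `paper:arxiv-2507.21400`, UNREFEREED, under adjudication at rung M-Hu-min of the campaign
`res-hironaka`); nothing of [Hu2025] is asserted; AI typing/proving is weaker than expert review. Provenance: res-type-016
(typer of record of row 109). What is proved (any chart ring `A`, any index type `V`, any readings `val0`, `val1`, any
relation family `rels`):
* `definedByWith_mono` — item (1) («Z̃ ∩ 𝔙 is defined by val0 (G), val1 (Γ̃¹) − 1, rels») is MONOTONE in the index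
  set `G` inside `{y | val0 y ∈ I(Z̃ ∩ 𝔙)}`;
* `gamma0Maximal_iff`, `gamma0Greatest_iff` — GIVEN item (1) at `Γ̃⁰_𝔙` (`DefinedBy`), each claim reading says exactly
  «every `y` with `val0 y ∈ I(Z̃ ∩ 𝔙)` lies in `Γ̃⁰_𝔙`», i.e. `gamma0Sat ⊆ Γ̃⁰_𝔙` (`gamma0Maximal_iff_gamma0Sat_subset`),
  and then `Γ̃⁰_𝔙 = gamma0Sat` (`coe_gamma0_eq_gamma0Sat`);
* `gamma0Maximal_iff_gamma0Greatest` — the two claim readings are EQUIVALENT; `gamma0_eq_of_gamma0Maximal` — under them «the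
  maximal subset» is unique (determined by the chart ideal and `val0`); `definedByWith_gamma0Sat` — and it EXISTS: any finite `S`
  with `↑S = gamma0Sat` satisfies item (1) (as soon as some index set does) and contains all index sets satisfying item (1).
A toy instance (n = 5) where the k = 0 data of the printed proof fails the clause is in `Lem73BaseMaximality.lean`.

## References
* [Hu2025] Y. Hu, arXiv:2507.21400v1 (2025), Lem. 7.3 C57L79–L139 (p.129–130), Lem. 7.4 (1) C60L4–L17 (p.134), Lem. 7.5 (1)
  C63L8–L21 (p.140) — cited as the loci of the typed definitions only (unrefereed manuscript under adjudication).
-/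

noncomputable section

namespace Literature.AlgebraicGeometry.Hu2025.Statements.S07GammaSchemes

/-! ## 1. The two readings of «the maximal subset» coincide, given item (1) -/

namespace GammaTransformChart

variable {V : Type*} {A : Type*} [CommRing A] {ι : Type*}

/-- If `Z̃ ∩ 𝔙` is defined by `val0 (G) , val1 (Γ̃¹) − 1, rels`, then every `val0 y`, `y ∈ G`, lies in its chart ideal.
[cite: Hu2025, Lem. 7.3 (1) C57L107–L125, p.129–130 (unrefereed manuscript under adjudication — kernel support over the typed carriers, nothing of the manuscript asserted)] -/
theorem val0_mem_of_definedByWith (D : GammaTransformChart V A) {val0 val1 : V → A} {rels : ι → A}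
    {G : Finset V} (h : D.DefinedByWith val0 val1 rels G) {y : V} (hy : y ∈ G) : val0 y ∈ D.zIdeal := by
  unfold DefinedByWith at h
  rw [h]
  exact Ideal.subset_span (Or.inl (Or.inl ⟨y, Finset.mem_coe.mpr hy, rfl⟩))

/-- **Monotonicity of item (1) in the index set.** If `Z̃ ∩ 𝔙` is defined by the relations at the index set `G`, it is
also defined by them at any larger `G' ⊇ G` all of whose `val0`-values lie in the chart ideal.
[cite: Hu2025, Lem. 7.3 (1) C57L107–L129, p.129–130 (unrefereed manuscript under adjudication — kernel support, nothing asserted)] -/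
theorem definedByWith_mono (D : GammaTransformChart V A) {val0 val1 : V → A} {rels : ι → A} {G G' : Finset V}
    (h : D.DefinedByWith val0 val1 rels G) (hGG' : G ⊆ G') (hG' : ∀ y ∈ G', val0 y ∈ D.zIdeal) :
    D.DefinedByWith val0 val1 rels G' := by
  unfold DefinedByWith at h ⊢
  apply le_antisymm
  · rw [h]
    apply Ideal.span_mono
    exact Set.union_subset_union_left _
      (Set.union_subset_union_left _ (Set.image_mono (Finset.coe_subset.mpr hGG')))
  · rw [Ideal.span_le]
    rintro x ((⟨y, hy, rfl⟩ | hx) | hx)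
    · exact hG' y (Finset.mem_coe.mp hy)
    · rw [h]
      exact Ideal.subset_span (Or.inl (Or.inr hx))
    · rw [h]
      exact Ideal.subset_span (Or.inr hx)

/-- **The maximal-element reading, unfolded.** Given item (1) at `Γ̃⁰_𝔙`, `Γ̃⁰_𝔙` is maximal among the index sets
satisfying (1) iff every index whose `val0`-value lies in the chart ideal of `Z̃ ∩ 𝔙` belongs to `Γ̃⁰_𝔙`.
[cite: Hu2025, Lem. 7.3 (1) C57L127–L129, p.130 (unrefereed manuscript under adjudication — kernel support over the typed readings, nothing asserted)] -/
theorem gamma0Maximal_iff [DecidableEq V] (D : GammaTransformChart V A) {val0 val1 : V → A} {rels : ι → A}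
    (h : D.DefinedBy val0 val1 rels) :
    D.Gamma0Maximal val0 val1 rels ↔ ∀ y, val0 y ∈ D.zIdeal → y ∈ D.gamma0 := by
  have h' : D.DefinedByWith val0 val1 rels D.gamma0 := h
  constructor
  · rintro ⟨-, hmax⟩ y hy
    have hins : D.DefinedByWith val0 val1 rels (insert y D.gamma0) := by
      refine definedByWith_mono D h' (Finset.subset_insert y _) ?_
      intro z hz
      rcases Finset.mem_insert.mp hz with rfl | hz
      · exact hy
      · exact val0_mem_of_definedByWith D h' hz
    have := hmax (insert y D.gamma0) hins (Finset.subset_insert y _)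
    rw [← this]
    exact Finset.mem_insert_self y _
  · intro hsat
    exact ⟨h, fun G hG hsub =>
      Finset.Subset.antisymm (fun z hz => hsat z (val0_mem_of_definedByWith D hG hz)) hsub⟩

/-- **The greatest-element reading, unfolded** — the same condition as `gamma0Maximal_iff`.
[cite: Hu2025, Lem. 7.3 (1) C57L127–L129, p.130 (unrefereed manuscript under adjudication — kernel support over the typed readings, nothing asserted)] -/
theorem gamma0Greatest_iff [DecidableEq V] (D : GammaTransformChart V A) {val0 val1 : V → A} {rels : ι → A}
    (h : D.DefinedBy val0 val1 rels) :
    D.Gamma0Greatest val0 val1 rels ↔ ∀ y, val0 y ∈ D.zIdeal → y ∈ D.gamma0 := by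
  have h' : D.DefinedByWith val0 val1 rels D.gamma0 := h
  constructor
  · rintro ⟨-, hgr⟩ y hy
    have hins : D.DefinedByWith val0 val1 rels (insert y D.gamma0) := by
      refine definedByWith_mono D h' (Finset.subset_insert y _) ?_
      intro z hz
      rcases Finset.mem_insert.mp hz with rfl | hz
      · exact hy
      · exact val0_mem_of_definedByWith D h' hz
    exact hgr (insert y D.gamma0) hins (Finset.mem_insert_self y _)
  · intro hsat
    exact ⟨h, fun G hG z hz => hsat z (val0_mem_of_definedByWith D hG hz)⟩

/-- **The maximality readings in terms of the definition reading `gamma0Sat`:** given item (1), `Γ̃⁰_𝔙` is maximal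
(equivalently greatest) iff `gamma0Sat ⊆ Γ̃⁰_𝔙`; and then `Γ̃⁰_𝔙 = gamma0Sat` as sets (the other inclusion is item (1)).
[cite: Hu2025, Lem. 7.3 (1) C57L127–L129, p.130 (unrefereed manuscript under adjudication — kernel support over the typed readings, nothing asserted)] -/
theorem gamma0Maximal_iff_gamma0Sat_subset [DecidableEq V] (D : GammaTransformChart V A) {val0 val1 : V → A}
    {rels : ι → A} (h : D.DefinedBy val0 val1 rels) :
    D.Gamma0Maximal val0 val1 rels ↔ D.gamma0Sat val0 ⊆ (D.gamma0 : Set V) := by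
  rw [gamma0Maximal_iff D h]
  exact Iff.rfl

/-- Given item (1) and maximality, `Γ̃⁰_𝔙` IS the definition-reading set `gamma0Sat`.
[cite: Hu2025, Lem. 7.3 (1) C57L127–L129, p.130 (unrefereed manuscript under adjudication — kernel support over the typed readings, nothing asserted)] -/
theorem coe_gamma0_eq_gamma0Sat [DecidableEq V] (D : GammaTransformChart V A) {val0 val1 : V → A}
    {rels : ι → A} (h : D.Gamma0Maximal val0 val1 rels) : (D.gamma0 : Set V) = D.gamma0Sat val0 := by
  apply Set.Subset.antisymm
  · intro y hy
    exact val0_mem_of_definedByWith D (show D.DefinedByWith val0 val1 rels D.gamma0 from h.1) (Finset.mem_coe.mp hy)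
  · exact (gamma0Maximal_iff_gamma0Sat_subset D h.1).mp h

/-- **The two typed readings of «the maximal subset» are equivalent** (both contain item (1) as a conjunct).
[cite: Hu2025, Lem. 7.3 (1) C57L127–L129; Lem. 7.4 (1) C60L15–L17; Lem. 7.5 (1) C63L19–L21 (unrefereed manuscript under adjudication — kernel support over the typed readings, nothing asserted)] -/
theorem gamma0Maximal_iff_gamma0Greatest [DecidableEq V] (D : GammaTransformChart V A) (val0 val1 : V → A)
    (rels : ι → A) : D.Gamma0Maximal val0 val1 rels ↔ D.Gamma0Greatest val0 val1 rels := by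
  constructor
  · intro hm
    exact (gamma0Greatest_iff D hm.1).2 ((gamma0Maximal_iff D hm.1).1 hm)
  · intro hg
    exact (gamma0Maximal_iff D hg.1).2 ((gamma0Greatest_iff D hg.1).1 hg)

/-- **The definition reading is realisable and greatest:** if SOME index set `G` satisfies item (1) and `S` is a finite index set
with `↑S = gamma0Sat` (e.g. `V` finite), then `S` satisfies item (1) and contains every index set satisfying item (1) — so «the
maximal subset (under inclusion) among all those subsets that satisfy the above» exists and equals `gamma0Sat`.
[cite: Hu2025, Lem. 7.3 (1) C57L127–L129 «the maximal subset»; p.130 (unrefereed manuscript under adjudication — kernel support over the typed readings, nothing asserted)] -/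
theorem definedByWith_gamma0Sat (D : GammaTransformChart V A) {val0 val1 : V → A} {rels : ι → A} {G : Finset V}
    (h : D.DefinedByWith val0 val1 rels G) (S : Finset V) (hS : (S : Set V) = D.gamma0Sat val0) :
    D.DefinedByWith val0 val1 rels S ∧ ∀ G' : Finset V, D.DefinedByWith val0 val1 rels G' → G' ⊆ S := by
  have hmemS : ∀ y, y ∈ S ↔ val0 y ∈ D.zIdeal := fun y => by
    rw [← Finset.mem_coe, hS]; rfl
  refine ⟨definedByWith_mono D h (fun y hy => (hmemS y).mpr (val0_mem_of_definedByWith D h hy))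
    (fun y hy => (hmemS y).mp hy), fun G' hG' y hy => (hmemS y).mpr (val0_mem_of_definedByWith D hG' hy)⟩

/-- **«THE maximal subset» is well defined under the claim readings:** two chart data with the same chart ideal `I(Z̃ ∩ 𝔙)`,
each satisfying item (1) with a maximal `Γ̃⁰`, have the same `Γ̃⁰` (whatever their `Γ̃¹`-parts and relation families) — both
equal `gamma0Sat`. [cite: Hu2025, Lem. 7.3 (1) C57L127–L129 «the maximal subset»; p.130 (unrefereed manuscript under adjudication — kernel support over the typed readings, nothing asserted)] -/
theorem gamma0_eq_of_gamma0Maximal [DecidableEq V] {ι' : Type*} (D D' : GammaTransformChart V A) {val0 val1 val1' : V → A}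
    {rels : ι → A} {rels' : ι' → A} (h : D.Gamma0Maximal val0 val1 rels) (h' : D'.Gamma0Maximal val0 val1' rels')
    (hz : D.zIdeal = D'.zIdeal) : D.gamma0 = D'.gamma0 := by
  apply Finset.coe_injective
  rw [coe_gamma0_eq_gamma0Sat D h, coe_gamma0_eq_gamma0Sat D' h']
  simp only [gamma0Sat, hz]

end GammaTransformChart

end Literature.AlgebraicGeometry.Hu2025.Statements.S07GammaSchemes

end

/-!
# Hu 2025 (arXiv:2507.21400v1) §7.2, Lemma 7.3 item (1) — the induction step along the PRE-IMAGE construction (7.3)/(7.10)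
# (C58L72–L80, p.131: «ρ⁻¹(Z_{𝔉[k−1],Γ}) ∩ 𝔙 = π⁻¹(Z_{𝔉[k−1],Γ}) ∩ 𝒱_[k] ∩ 𝔙 … apply Lemma 7.3 (1) in the case of ℛ_{𝔉[k−1]} …
# apply Proposition 4.56 to 𝒱_[k] ∩ 𝔙, and …») — KERNEL SUPPORT: at the level of the typed shapes this step is ideal bookkeeping
# (contrast: the STRICT-transform step of Lemma 7.4 (1), joint J3 / `C60L75`, is not — see `Lem74Inference.lean`)

**Honest framing (D-0012/D-0089).** A kernel fact about TYPED shapes of row 109 file b (`GammaTransformChart.DefinedByWith`, the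
construction shape `C58L13` and the Γ̃⁰-update shape `C58L64`), taking no side on the manuscript [Hu2025] (arXiv:2507.21400v1,
`paper:arxiv-2507.21400`, UNREFEREED, under adjudication at rung M-Hu-min of the campaign `res-hironaka`); nothing of [Hu2025]
is asserted. Provenance: res-type-016 (typer of record of row 109). `definedByWith_of_preimage_step`: if `Z′ ∩ 𝔙′` is defined by
`var′ (G₀′)` and `rels′`, the new chart ideal is `I(Z′ ∩ 𝔙′)·A + I(𝒱 ∩ 𝔙) + (xRho t : t ∈ Λ⁰)` (shape `C58L13`) with
`I(𝒱 ∩ 𝔙) = ⟨vrels⟩` (Prop. 4.56's equations, DATA), and the variables of `𝔙` extend those of `𝔙′` compatibly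
(`var (ι y′) = ρ (var′ y′)`, `var (idxRho t) = xRho t`), then `Z ∩ 𝔙` is defined by `var` on `ι(G₀′) ∪ idxRho(Λ⁰)` (the shape of
`C58L64`) together with the family `ρ ∘ rels′` ⊔ `vrels` — for ANY rings and maps. So item (1) of Lemma 7.3 propagates along its
own construction by bookkeeping; and `gamma0Sat_preimage_step_superset`: the Γ̃⁰-update (7.6)/(7.11) always lands INSIDE the new
`gamma0Sat` (a lower bound for the definition reading) — whether it is ALL of it (the maximality clause) is a different matter
(`ChartReadings.lean`, `Lem73BaseMaximality.lean`).

## References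
* [Hu2025] Y. Hu, arXiv:2507.21400v1 (2025), Lem. 7.3 (1) C57L107–L129, constructions (7.3) C58L8–L14 / (7.6) C58L63–L66, proof of (1)
  C58L72–L80 (p.129–131) — loci of the typed definitions only (unrefereed manuscript under adjudication).
-/

namespace Literature.AlgebraicGeometry.Hu2025.Statements.S07GammaSchemes

namespace GammaTransformChart

variable {V V' : Type*} {A A' : Type*} [CommRing A] [CommRing A'] {T ι κ : Type*}

/-- **Item (1) propagates along the pre-image construction (7.3)/(7.10) by bookkeeping.** See the module docstring for the
hypotheses; the conclusion is the typed `DefinedByWith` at the index set `ι(G₀′) ∪ idxRho(Λ⁰)` with the relation family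
`Sum.elim (ρ ∘ rels′) vrels` and `Γ̃¹ = ∅`.
[cite: Hu2025, Lem. 7.3 (1) proof C58L72–L80 with (7.3) C58L8–L14 and (7.6) C58L63–L66; p.130–131 (unrefereed manuscript under adjudication — kernel support over the typed shapes, nothing of the manuscript asserted)] -/
theorem definedByWith_of_preimage_step [DecidableEq V] (ρ : A' →+* A) (var' : V' → A') (var : V → A) (emb : V' → V)
    (idxRho : T → V) (xRho : T → A) (rels' : ι → A') (vrels : κ → A) (lambdaZero : Finset T) (G0' : Finset V')
    (D' : GammaTransformChart V' A') (D : GammaTransformChart V A)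
    (hD' : D'.DefinedByWith var' var' rels' G0') (h1' : D'.gamma1 = ∅) (h1 : D.gamma1 = ∅)
    (hz : C58L13 ρ (Ideal.span (Set.range vrels)) xRho (lambdaZero : Set T) D'.zIdeal D.zIdeal)
    (hvar1 : ∀ y', var (emb y') = ρ (var' y')) (hvar2 : ∀ t, var (idxRho t) = xRho t) :
    D.DefinedByWith var var (Sum.elim (fun i => ρ (rels' i)) vrels) (G0'.image emb ∪ lambdaZero.image idxRho) := by
  unfold DefinedByWith at hD' ⊢
  have hz' : D.zIdeal = D'.zIdeal.map ρ ⊔ Ideal.span (Set.range vrels) ⊔ Ideal.span (xRho '' (lambdaZero : Set T)) := hz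
  rw [h1'] at hD'
  rw [h1, hz', hD', Ideal.map_span]
  simp only [Finset.coe_empty, Set.image_empty, Set.union_empty, Finset.coe_union, Finset.coe_image, Set.image_union,
    Set.Sum.elim_range, Ideal.span_union, Set.image_image]
  -- both sides are the same four spans, up to the variable bookkeeping `hvar1` / `hvar2` and the order of `⊔`
  have e1 : (fun y' => ρ (var' y')) '' (G0' : Set V') = (fun y' => var (emb y')) '' (G0' : Set V') :=
    Set.image_congr' fun y' => (hvar1 y').symm
  have e2 : xRho '' (lambdaZero : Set T) = (fun t => var (idxRho t)) '' (lambdaZero : Set T) :=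
    Set.image_congr' fun t => (hvar2 t).symm
  have e3 : ρ '' Set.range rels' = Set.range (fun i => ρ (rels' i)) := (Set.range_comp _ _).symm
  rw [e1, e2, e3]
  ac_rfl

/-- **The Γ̃⁰-update (7.6)/(7.11) is a LOWER BOUND for the definition reading**: along a pre-image step of shape `C58L13`, every
index of `ι(gamma0Sat′) ∪ idxRho(Λ⁰)` lies in the new `gamma0Sat` — for any rings and maps. (Equality, i.e. maximality of the
updated set, is NOT automatic: `Lem73BaseMaximality.lean`.)
[cite: Hu2025, Lem. 7.3 proof (7.6) C58L63–L66 / (7.11) C59L72–L75 with (1) C57L127–L129; p.130–133 (unrefereed manuscript under adjudication — kernel support over the typed shapes, nothing of the manuscript asserted)] -/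
theorem gamma0Sat_preimage_step_superset (ρ : A' →+* A) (var' : V' → A') (var : V → A) (emb : V' → V)
    (idxRho : T → V) (xRho : T → A) (vIdeal : Ideal A) (lambdaZero : Set T)
    (D' : GammaTransformChart V' A') (D : GammaTransformChart V A)
    (hz : C58L13 ρ vIdeal xRho lambdaZero D'.zIdeal D.zIdeal)
    (hvar1 : ∀ y', var (emb y') = ρ (var' y')) (hvar2 : ∀ t, var (idxRho t) = xRho t) :
    emb '' D'.gamma0Sat var' ∪ idxRho '' lambdaZero ⊆ D.gamma0Sat var := by
  have hz' : D.zIdeal = D'.zIdeal.map ρ ⊔ vIdeal ⊔ Ideal.span (xRho '' lambdaZero) := hz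
  rintro y (⟨y', hy', rfl⟩ | ⟨t, ht, rfl⟩)
  · show var (emb y') ∈ D.zIdeal
    rw [hvar1, hz']
    exact Ideal.mem_sup_left (Ideal.mem_sup_left (Ideal.mem_map_of_mem ρ hy'))
  · show var (idxRho t) ∈ D.zIdeal
    rw [hvar2, hz']
    exact Ideal.mem_sup_right (Ideal.subset_span ⟨t, ht, rfl⟩)

end GammaTransformChart

/-! ## Inhabitation note for the CHOICE record `LambdaDetChoice` (Lem. 7.3, irrelevant case, C59L16–L25) -/

section LambdaDetSanity

variable {T 𝔗 : Type*}

/-- **The requirements record `LambdaDetChoice` is inhabited as soon as its two predicate parameters allow it** — e.g. with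
`AchievesMaxRank := fun _ => True` the choice `Λ^det := ∅`, `Λ^{=0} := {t | rel t = F}` satisfies every field. This is a
VACUITY note for the lanes (the record constrains nothing beyond its parameters; the printed content is in HOW rows 103–105
instantiate `AchievesMaxRank` / `VanishesOnDaggerOpen`), not a claim about the manuscript.
[cite: Hu2025, Lem. 7.3 proof C59L16–L25 / C59L43–L53; p.132 (unrefereed manuscript under adjudication — kernel inhabitation witness for the typed record, nothing of the manuscript asserted)] -/
theorem LambdaDetChoice.nonempty_of_trivialRank [Fintype T] [DecidableEq 𝔗] (rel : T → 𝔗) (F : 𝔗) (Q : T → Prop) :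
    Nonempty (LambdaDetChoice rel F (fun _ => True) Q) :=
  ⟨{ det := ∅
     zero := Finset.univ.filter fun t => rel t = F
     det_rel := by simp
     det_maxRank := trivial
     zero_spec := by simp }⟩

end LambdaDetSanity

end Literature.AlgebraicGeometry.Hu2025.Statements.S07GammaSchemes
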